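import Summits.ResolutionOfSingularities.ResolutionOfSingularities.Theses.PAlteration
import Summits.ResolutionOfSingularities.ResolutionOfSingularities.Theorems.PAlterationAssemblyPerfect
import Summits.ResolutionOfSingularities.ResolutionOfSingularities.Theorems.PAlterationPicoverToRadicialBottomFrobeniusFactorGeneric
import Summits.ResolutionOfSingularities.ResolutionOfSingularities.Theorems.PAlterationPicoverToRadicialBottomRelFrobeniusTwisted
import Summits.ResolutionOfSingularities.ResolutionOfSingularities.Theorems.PAlterationPicoverToRadicialBottomPBasisDerivations
import Summits.ResolutionOfSingularities.ResolutionOfSingularities.Theorems.PAlterationPicoverToRadicialBottomDerivationQuotientMvPolynomial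
import Summits.ResolutionOfSingularities.ResolutionOfSingularities.Theorems.PAlterationPicoverToRadicialBottomRegularTensorAdjoinRoots
import Summits.ResolutionOfSingularities.ResolutionOfSingularities.Theorems.PAlterationPicoverToRadicialBottomDirectedUnionRegular
import Summits.ResolutionOfSingularities.ResolutionOfSingularities.Theorems.PAlterationPicoverToRadicialBottomCofiniteRegularTwistGlue
import Literature.AlgebraicGeometry.Resolution.ResolutionGlue
import Literature.AlgebraicGeometry.Resolution.PrincipalizationToResolution

/-!
# `PAlteration.PicoverToRadicialBottom` (stmt-ResolutionOfSingularities-0556) — PROVED, for every ground field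

Route `ResolutionOfSingularities/pAlteration`, crux `PicoverToRadicialBottom` (rank 4):
`∀ p prime, PICover_p → RadicialBottom_p` — if `g : X'' → X` is finite, universally injective and
surjective between integral schemes, `X` separated of finite type over a field `k` of
characteristic `p`, and `X''` has a resolution, then `X` has a resolution, GIVEN that finite
radicial covers of regular varieties over fields of characteristic `p` have resolutions. The
proof works for EVERY `k` (no `[k : k^p] < ∞`): line `theta-finite-cofinite-roots` of the crux
chain (idea card `Cruxes/PicoverToRadicialBottom/Ideas/theta-finite-cofinite-roots.md`).

Proof (`picoverToRadicialBottom_proof`). Let `π : Z → X''` be a resolution, `ρ := π ≫ g`. Over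
`U := X ∖ g(X'' ∖ V)` (`V` the iso-locus of `π`) `ρ` is finite and radicial, so over a non-empty
affine `W ≤ U` the `p^N`-Frobenius of `Γ(ρ⁻¹W)` factors through `Γ(W)`
(`stub_frobeniusFactorGeneric`). By `cofiniteRegularTwist` (the Θ-finite cofinite `p`-basis
lemma: `stub_pBasisDerivations` + `stub_derivationQuotientMvPolynomial` +
`stub_regularTensorAdjoinRoots` + `stub_directedUnionRegular`, glued by
`stub_cofiniteRegularTwistGlue`) there is a field `L ⊇ k` with `ψ : L → k`, `ψ(x) = x^{p^N}`,
`k` FINITE over `ψ(L)`, and `Z ×ₖ Spec L` REGULAR. The twisted relative Frobenius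
`Ψ : X → X_L := Spec L ×ₖ X` is finite, radicial and surjective with `Ψ ≫ pr = F_X^N`
(`stub_relFrobeniusTwisted`). With `Y' := Z ×_X X_L ≅ Z ×ₖ Spec L` (regular, integral,
separated of finite type over the field `L`) and `ρ_L : Y' → X_L` the base change of `ρ`, the
reduced pull-back `T := (X ×_{Ψ, X_L} Y')_red` is integral and finite, radicial, surjective over
`Y'`, so `PICover_p` over `L` resolves `T`; and `T → X` is proper and birational (over `W` it is
injective with the section `w ↦ (w, (σ-point of w, Ψ w))`), hence `X` has a resolution
(`Scheme.HasResolution.of_isBirational`).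
-/

noncomputable section

-- single-problem summit: the doubled namespace component `ResolutionOfSingularities` is forced
set_option linter.dupNamespace false

open CategoryTheory CategoryTheory.Limits AlgebraicGeometry TopologicalSpace Topology
open scoped TensorProduct
open Literature.AlgebraicGeometry.Resolution Literature.AlgebraicGeometry.Motives
open Scheme.IdealSheafData
open Summit.ResolutionOfSingularities.ResolutionOfSingularities.Theses.PAlteration

namespace Summit.ResolutionOfSingularities.ResolutionOfSingularities.Theorems

/-- **The cofinite regular twist** (planner's stub `stub_cofiniteRegularTwist`): for `Z` regular
of finite type over a field `k` of characteristic `p` and `r ≥ 0` there is a field `L ⊇ k` with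
`ψ : L → k`, `ψ(x) = x^{p^r}` (so `k ⊆ L ⊆ k^{1/p^r}`), `k` FINITE over `ψ(L)`, and `Z ×ₖ Spec L`
regular (`L = k(good p^r-th roots)` of a Θ-finite-sorted `p`-basis; Matsumura Thm. 30.5,
Stacks 07PG). [cite: Matsumura1987, Thm. 30.5] -/
theorem cofiniteRegularTwist :
    ∀ (p : ℕ) [Fact p.Prime] (k : Type) [Field k] [CharP k p] (Z : Scheme.{0})
      (fZ : Z ⟶ Spec (.of k)) [LocallyOfFiniteType fZ] [QuasiCompact fZ], Scheme.IsRegular Z →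
      ∀ r : ℕ, ∃ (L : Type) (_ : Field L) (_ : Algebra k L) (ψ : L →+* k),
        (∀ x : L, algebraMap k L (ψ x) = x ^ p ^ r) ∧ (∀ a : k, ψ (algebraMap k L a) = a ^ p ^ r) ∧
        ψ.Finite ∧ Scheme.IsRegular (pullback fZ (Spec.map (CommRingCat.ofHom (algebraMap k L)))) :=
  stub_cofiniteRegularTwistGlue stub_pBasisDerivations stub_derivationQuotientMvPolynomial
    stub_regularTensorAdjoinRoots stub_directedUnionRegular

/-! ## Composition -/

section Composition

/-- A proper morphism whose restriction over a dense open is an isomorphism is surjective (its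
image is closed and contains the dense open). [folklore] -/
theorem surjective_of_isBirational_of_universallyClosed {X' X : Scheme.{0}} (π : X' ⟶ X)
    [UniversallyClosed π] (h : IsBirational π) : Surjective π := by
  obtain ⟨U, hU, -, hiso⟩ := h
  refine ⟨fun x => ?_⟩
  have hcl : IsClosed (Set.range π.base) := π.isClosedMap.isClosed_range
  have hsub : (U : Set X) ⊆ Set.range π.base := by
    intro u hu
    obtain ⟨y, hy⟩ := (inferInstance : Surjective (π ∣_ U)).1 ⟨u, hu⟩
    refine ⟨y.1, ?_⟩
    have := congrArg Subtype.val hy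
    rwa [morphismRestrict_base_coe] at this
  have hx : x ∈ closure (U : Set X) := hU x
  exact (hcl.closure_subset_iff.mpr hsub) hx

/-- The pull-back of an irreducible scheme along a universal homeomorphism is irreducible
(`pullback.fst` version of `irreducibleSpace_pullback_of_universallyClosed`). [folklore] -/
theorem irreducibleSpace_pullback_fst_of_universallyClosed {X Y T : Scheme.{0}} (ρ : Y ⟶ T)
    (h : X ⟶ T) [UniversallyClosed h] [UniversallyInjective h] [Surjective h] [IrreducibleSpace Y] :
    IrreducibleSpace ↑(pullback ρ h) :=
  haveI : UniversallyInjective (pullback.fst ρ h) :=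
    MorphismProperty.pullback_fst (P := @UniversallyInjective) _ _ ‹_›
  (isHomeomorph_of_universallyClosed_of_universallyInjective
    (pullback.fst ρ h)).homeomorph.irreducibleSpace_iff.mpr ‹_›

end Composition

/-! ## The crux, by name -/

-- as in Mathlib's pullback API for schemes / `morphismRestrict_app`
set_option backward.isDefEq.respectTransparency false in
set_option maxHeartbeats 800000 in
/-- **`PICover_p ⇒ RadicialBottom_p` for every prime `p` and EVERY ground field `k`** (crux
`PicoverToRadicialBottom`, line `theta-finite-cofinite-roots`; see the module docstring). Let `g : X'' → X` be finite,
universally injective and surjective between integral schemes, `X` separated of finite type over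
`k` (`char k = p`), `π : Z → X''` a resolution; put `ρ := π ≫ g`. Over the open
`U := X ∖ g(X'' ∖ V)` (`V` the iso-locus of `π`) `ρ` is finite and radicial, so over a non-empty
affine `W ≤ U` its `p^N`-Frobenius factors through `Γ(W)` (`stub_frobeniusFactorGeneric`). Let
`L ⊇ k`, `ψ : L → k` finite with `ψ(x) = x^{p^N}` and `Z_L := Z ×ₖ Spec L` REGULAR
(`stub_cofiniteRegularTwist`), and `Ψ : X → X_L := Spec L ×ₖ X` the twisted relative Frobenius,
finite, radicial, surjective with `Ψ ≫ pr = F_X^N` (`stub_relFrobeniusTwisted`). With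
`Y' := Z ×_X X_L ≅ Z_L` (regular, integral, separated of finite type over the field `L`) and
`ρ_L : Y' → X_L` the base change of `ρ`, the reduced pull-back `T := (X ×_{Ψ, X_L} Y')_red` is
integral and finite, radicial, surjective over `Y'`, so `PICover_p` over the field `L` resolves
`T`; and `T → X` is proper and birational: over `W` it is injective and has the section
`w ↦ (w, (σ-point of w, Ψ w))`, hence is an isomorphism there. [folklore] -/
theorem picoverToRadicialBottom_proof : PicoverToRadicialBottom := by
  intro p hp hPC k _ _ X X'' f g hsep hlft hqc hXint hX''int hgfin hgui hgsurj hres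
  haveI : Fact p.Prime := ⟨hp⟩
  haveI := hsep; haveI := hlft; haveI := hqc; haveI := hXint; haveI := hX''int
  haveI := hgfin; haveI := hgui
  haveI : Surjective g := ⟨hgsurj⟩
  obtain ⟨Z, π, hπ⟩ := hres
  haveI := hπ.isProper
  have hZreg : Scheme.IsRegular Z := hπ.isRegular
  -- `Z` is integral
  haveI : IrreducibleSpace Z := hπ.isBirational.irreducibleSpace
  haveI : IsReduced Z := hZreg.isReduced
  haveI : IsIntegral Z := isIntegral_of_irreducibleSpace_of_isReduced Z
  haveI : Surjective π := surjective_of_isBirational_of_universallyClosed π hπ.isBirational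
  obtain ⟨V, hVd, -, hVi⟩ := hπ.isBirational
  -- Step 1: the open `U = X ∖ g(X'' ∖ V)` over which `ρ = π ≫ g` is finite and radicial
  have hgcl : IsClosed (g.base '' (V : Set X'')ᶜ) := g.isClosedMap _ V.2.isClosed_compl
  let U : X.Opens := ⟨(g.base '' (V : Set X'')ᶜ)ᶜ, hgcl.isOpen_compl⟩
  have hgU : g ⁻¹ᵁ U ≤ V := by
    intro x hx
    by_contra hxV
    exact hx ⟨x, hxV, rfl⟩
  obtain ⟨v, hv⟩ := hVd.nonempty
  have hvU : g.base v ∈ U := by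
    rintro ⟨x, hx, hxe⟩
    exact hx (by rwa [g.injective hxe])
  haveI : Nonempty ↥U := ⟨⟨g.base v, hvU⟩⟩
  haveI : IsIso (π ∣_ g ⁻¹ᵁ U) := isIso_morphismRestrict_of_le π hVi hgU
  haveI : IsFinite (g ∣_ U) := IsZariskiLocalAtTarget.restrict hgfin U
  haveI : UniversallyInjective (g ∣_ U) := IsZariskiLocalAtTarget.restrict hgui U
  haveI hρUfin : IsFinite ((π ≫ g) ∣_ U) := by
    rw [morphismRestrict_comp]; infer_instance
  haveI hρUui : UniversallyInjective ((π ≫ g) ∣_ U) := by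
    rw [morphismRestrict_comp]
    exact MorphismProperty.comp_mem @UniversallyInjective _ _ inferInstance inferInstance
  -- characteristic
  have hpX : (p : Γ(X, ⊤)) = 0 := natCast_appTop_eq_zero p f
  -- Step 2: the Frobenius factor over an affine `W ≤ U`
  obtain ⟨W, hW, hWne, hWU, N, σ, hσ1, hσ2⟩ := stub_frobeniusFactorGeneric p Z X (π ≫ g) U hpX
  obtain ⟨⟨u, huW⟩⟩ := hWne
  haveI : Nonempty ↥W := ⟨⟨u, huW⟩⟩
  haveI : Nonempty ↑(W : Scheme.{0}) := ⟨⟨u, huW⟩⟩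
  haveI : IsAffine W := hW
  haveI hρWfin : IsFinite ((π ≫ g) ∣_ W) := restrict_of_le (π ≫ g) hWU hρUfin
  haveI hρWui : UniversallyInjective ((π ≫ g) ∣_ W) := restrict_of_le (π ≫ g) hWU hρUui
  haveI : IsIntegral (W : Scheme.{0}) := isIntegral_of_isOpenImmersion W.ι
  -- Step 3: the cofinite regular twist of `Z`
  obtain ⟨L, instL, instA, ψ, hψ1, hψ2, hψfin, hYreg⟩ :=
    cofiniteRegularTwist p k Z ((π ≫ g) ≫ f) hZreg N
  letI := instL
  letI := instA
  haveI : CharP L p := charP_of_injective_algebraMap (algebraMap k L).injective p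
  have hrad : ∀ x : L, ∃ (n : ℕ) (y : k), algebraMap k L y = x ^ p ^ n := fun x => ⟨N, ψ x, hψ1 x⟩
  set iL : Spec (.of L) ⟶ Spec (.of k) := Spec.map (CommRingCat.ofHom (algebraMap k L)) with hiL
  haveI : UniversallyInjective iL := universallyInjective_specMap_field_of_pow_mem _ p hrad
  haveI : Surjective iL := surjective_specMap_field _
  haveI : IsIntegralHom iL := isIntegralHom_specMap_of_pow_mem _ p hrad
  -- Step 4: the twisted relative Frobenius `Ψ : X → X_L`
  set F := powEndo X (p ^ N) (pow_ne_zero N (Fact.out : p.Prime).ne_zero)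
    (add_pow_prime_pow_sections X p hpX N) with hFdef
  obtain ⟨Ψ, hΨfin, hΨui, hΨsurj, hΨfst, -⟩ :=
    stub_relFrobeniusTwisted p k L N ψ hψ1 hψ2 hψfin X f hpX
  haveI := hΨfin; haveI := hΨui; haveI := hΨsurj
  set h' := pullback.fst f iL with hh'
  haveI : UniversallyInjective h' := MorphismProperty.pullback_fst (P := @UniversallyInjective) _ _ ‹_›
  -- Step 5: `Y' = Z ×_X X_L ≅ Z_L`, regular and integral; `ρ_L : Y' → X_L` proper
  set Y' := pullback (π ≫ g) h' with hY'
  set ρL := pullback.snd (π ≫ g) h' with hρL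
  have hY'reg : Scheme.IsRegular Y' :=
    Scheme.IsRegular.of_iso (pullbackRightPullbackFstIso f iL (π ≫ g)).inv hYreg
  haveI : IrreducibleSpace ↥Y' := irreducibleSpace_pullback_fst_of_universallyClosed (π ≫ g) h'
  haveI : IsReduced Y' := hY'reg.isReduced
  haveI hY'int : IsIntegral Y' := isIntegral_of_irreducibleSpace_of_isReduced Y'
  -- Step 6: the reduced pull-back `T` and its resolution from `PICover_p` over `L`
  set T := (vanishingIdeal (⊤ : Closeds ↑(pullback Ψ ρL))).subscheme with hTdef
  set ι := (vanishingIdeal (⊤ : Closeds ↑(pullback Ψ ρL))).subschemeι with hιdef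
  haveI hTint : IsIntegral T := isIntegral_reduced_pullback Ψ ρL
  have hTres : Scheme.HasResolution T :=
    hPC L Y' T (ρL ≫ pullback.snd f iL) (ι ≫ pullback.snd Ψ ρL) inferInstance inferInstance
      inferInstance hY'int hY'reg hTint (isFinite_reduced_pullback_snd Ψ ρL)
      (universallyInjective_reduced_pullback_snd Ψ ρL) (surjective_reduced_pullback_snd Ψ ρL).1
  -- Step 7: `πT : T → X` is proper and birational
  set πT := ι ≫ pullback.fst Ψ ρL with hπTdef
  haveI : IsProper πT := inferInstance
  refine Scheme.HasResolution.of_isBirational πT ⟨W, W.2.dense ⟨u, huW⟩, ?_, ?_⟩ hTres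
  · refine (πT ⁻¹ᵁ W).2.dense ?_
    obtain ⟨z, hz⟩ := (inferInstance : Surjective πT).1 u
    exact ⟨z, show πT.base z ∈ W by rw [hz]; exact huW⟩
  -- points of `T` over `W`: their images in `Z`
  have himg : ∀ c : ↥(πT ⁻¹ᵁ W),
      (π ≫ g).base ((pullback.fst (π ≫ g) h').base ((pullback.snd Ψ ρL).base (ι.base c.1))) =
        πT.base c.1 := by
    intro c
    rw [← Scheme.Hom.comp_apply _ (π ≫ g), pullback.condition, Scheme.Hom.comp_apply,
      ← Scheme.Hom.comp_apply _ ρL, ← pullback.condition, Scheme.Hom.comp_apply,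
      ← Scheme.Hom.comp_apply _ h', hΨfst]
    rfl
  have hinj : Function.Injective (πT ∣_ W).base := by
    intro a b hab
    have h1 : πT.base a.1 = πT.base b.1 := by
      have := congrArg Subtype.val hab
      rwa [morphismRestrict_base_coe, morphismRestrict_base_coe] at this
    have hz : (pullback.fst (π ≫ g) h').base ((pullback.snd Ψ ρL).base (ι.base a.1)) =
        (pullback.fst (π ≫ g) h').base ((pullback.snd Ψ ρL).base (ι.base b.1)) := by
      have hmem : ∀ c : ↥(πT ⁻¹ᵁ W),
          (pullback.fst (π ≫ g) h').base ((pullback.snd Ψ ρL).base (ι.base c.1)) ∈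
            (π ≫ g) ⁻¹ᵁ W := fun c =>
        show (π ≫ g).base _ ∈ W by rw [himg c]; exact c.2
      have key : ((π ≫ g) ∣_ W).base ⟨_, hmem a⟩ = ((π ≫ g) ∣_ W).base ⟨_, hmem b⟩ := by
        apply Subtype.ext
        rw [morphismRestrict_base_coe, morphismRestrict_base_coe, himg, himg]
        exact h1
      exact congrArg Subtype.val (((π ≫ g) ∣_ W).injective key)
    haveI : UniversallyInjective (pullback.fst (π ≫ g) h') :=
      MorphismProperty.pullback_fst (P := @UniversallyInjective) _ _ ‹_›
    have hy := (pullback.fst (π ≫ g) h').injective hz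
    exact Subtype.ext (ι.isClosedEmbedding.injective ((pullback.snd Ψ ρL).injective hy))
  -- the section over `W`: first `b₀ : W → ρ⁻¹ W`, `Spec` of the Frobenius factor `σ`
  have hpW : (p : Γ((W : Scheme.{0}), ⊤)) = 0 := by
    rw [← map_natCast W.ι.appTop.hom p, hpX, map_zero]
  haveI : IsAffine ((π ≫ g) ⁻¹ᵁ W : Scheme.{0}) := isAffine_of_isAffineHom ((π ≫ g) ∣_ W)
  have haddW := add_pow_sections p hpW N
  have hpS : (p : Γ(Spec Γ((W : Scheme.{0}), ⊤), ⊤)) = 0 :=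
    natCast_appTop_eq_zero p ((W : Scheme.{0}).isoSpec.inv ≫ W.ι ≫ f)
  have haddS := add_pow_sections p hpS N
  let τ : Γ(((π ≫ g) ⁻¹ᵁ W : Scheme.{0}), ⊤) ⟶ Γ((W : Scheme.{0}), ⊤) := CommRingCat.ofHom σ
  have e1 : ((π ≫ g) ∣_ W).appTop ≫ τ = CommRingCat.ofHom (powRingHom Γ((W : Scheme.{0}), ⊤)
      (p ^ N) (pow_ne_zero N hp.ne_zero) (haddW ⊤)) := by
    ext a
    simp only [τ, CommRingCat.hom_comp, CommRingCat.hom_ofHom, RingHom.comp_apply, powRingHom_apply]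
    exact hσ2 a
  let b₀ : (W : Scheme.{0}) ⟶ ((π ≫ g) ⁻¹ᵁ W : Scheme.{0}) :=
    (W : Scheme.{0}).isoSpec.hom ≫ Spec.map τ ≫ ((π ≫ g) ⁻¹ᵁ W : Scheme.{0}).isoSpec.inv
  have hb₀ : b₀ ≫ ((π ≫ g) ∣_ W) =
      powEndo (W : Scheme.{0}) (p ^ N) (pow_ne_zero N hp.ne_zero) haddW := by
    have h1 : ((π ≫ g) ⁻¹ᵁ W : Scheme.{0}).isoSpec.inv ≫ ((π ≫ g) ∣_ W) =
        Spec.map ((π ≫ g) ∣_ W).appTop ≫ (W : Scheme.{0}).isoSpec.inv :=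
      (Scheme.isoSpec_inv_naturality _).symm
    have h3 : Spec.map (CommRingCat.ofHom (powRingHom Γ((W : Scheme.{0}), ⊤) (p ^ N)
        (pow_ne_zero N hp.ne_zero) (haddW ⊤))) =
        powEndo (Spec Γ((W : Scheme.{0}), ⊤)) (p ^ N) (pow_ne_zero N hp.ne_zero) haddS :=
      (powEndo_Spec (p ^ N) (pow_ne_zero N hp.ne_zero) (Γ((W : Scheme.{0}), ⊤)) (haddW ⊤) haddS).symm
    have h2 : Spec.map τ ≫ Spec.map ((π ≫ g) ∣_ W).appTop =
        powEndo (Spec Γ((W : Scheme.{0}), ⊤)) (p ^ N) (pow_ne_zero N hp.ne_zero) haddS := by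
      rw [← Spec.map_comp, e1, h3]
    have h4 : (W : Scheme.{0}).isoSpec.hom ≫
        powEndo (Spec Γ((W : Scheme.{0}), ⊤)) (p ^ N) (pow_ne_zero N hp.ne_zero) haddS =
        powEndo (W : Scheme.{0}) (p ^ N) (pow_ne_zero N hp.ne_zero) haddW ≫
          (W : Scheme.{0}).isoSpec.hom :=
      (powEndo_comp (p ^ N) (pow_ne_zero N hp.ne_zero) haddW _ haddS).symm
    simp only [b₀, Category.assoc]
    rw [h1, ← Category.assoc (Spec.map τ), h2, ← Category.assoc, h4, Category.assoc, Iso.hom_inv_id,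
      Category.comp_id]
  -- the point of `Y'` over `W`, then of the pull-back, then of `T`
  have hw : (b₀ ≫ ((π ≫ g) ⁻¹ᵁ W).ι) ≫ (π ≫ g) = (W.ι ≫ Ψ) ≫ h' := by
    rw [Category.assoc, ← morphismRestrict_ι, ← Category.assoc, hb₀, Category.assoc, hΨfst]
    exact powEndo_comp (p ^ N) (pow_ne_zero N hp.ne_zero) haddW W.ι
      (add_pow_prime_pow_sections X p hpX N)
  let yW : (W : Scheme.{0}) ⟶ Y' := pullback.lift (b₀ ≫ ((π ≫ g) ⁻¹ᵁ W).ι) (W.ι ≫ Ψ) hw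
  have hyW : W.ι ≫ Ψ = yW ≫ ρL := by rw [hρL, pullback.lift_snd]
  obtain ⟨s₁, hs₁⟩ := exists_lift_reduced (pullback.lift W.ι yW hyW)
  have hs₁π : s₁ ≫ πT = W.ι := by
    rw [hπTdef, ← Category.assoc, hιdef, hs₁, pullback.lift_fst]
  have hrange : Set.range s₁.base ⊆ Set.range (πT ⁻¹ᵁ W).ι.base := by
    rintro _ ⟨w, rfl⟩
    rw [Scheme.Opens.range_ι]
    show πT.base (s₁.base w) ∈ W
    rw [← Scheme.Hom.comp_apply, hs₁π]
    exact w.2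
  have hs : IsOpenImmersion.lift (πT ⁻¹ᵁ W).ι s₁ hrange ≫ (πT ∣_ W) = 𝟙 _ := by
    rw [← cancel_mono W.ι, Category.assoc, morphismRestrict_ι, ← Category.assoc,
      IsOpenImmersion.lift_fac, hs₁π, Category.id_comp]
  exact isIso_of_comp_eq_id_of_injective (πT ∣_ W) hinj _ hs

end Summit.ResolutionOfSingularities.ResolutionOfSingularities.Theorems

end
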